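import Literature.MathematicalPhysics.QuantumFieldTheory.Balaban1983to89.B6AvgWeightsKLevelV1

/-!
# `Balaban1983to89.B6IndexBondLayersKLevelV1` — T. Bałaban, *Propagators and renormalization transformations for lattice gauge theories. II*, Commun. Math. Phys.
# **96** (1984) 223–250 [Balaban1984PropagatorsII], (2.3)–(2.4) p. 224 (the index bonds `Λ_j`) and (2.20) p. 226 (`Q`) with [Balaban1984PropagatorsI] (1.18) p. 20: THE
# TOTAL WEIGHT A FINE BOND RECEIVES FROM ONE LEVEL IS AT MOST THE PLATEAU `L^{−jD}`, the index bonds of one level∕source∕direction are UNIQUE, an observer of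
# a fine bond of the BASE block of `y` has level `j(y)` or `j(y)+1`, and the ε-LAYER of the base block (far side if the base is the source, near side if it is
# the target) carries own weight `≥ (1−ε)L^{−jD}` — the geometric half of the row-26 approximate right inverse (P′2)

statement-level skeleton of published theorems with citation tags; proofs where landed; nothing here is a claim about the Yang–Mills mass gap

THE PRINT.  [4] p. 224 (2.3): *«Λ_j also denotes the set of bonds with at least one end-point in Λ_j»* (r03's `LamBond j b :↔ (b₋ ∈ Ω_j^{(j)} ∨ b₊ ∈ Ω_j^{(j)}) ∧ ¬Deep b₋ ∧
¬Deep b₊`: an index bond of level `j` has BOTH end blocks of level `≤ j` and its BASE end (`B6Ineq2142KLevelV1.base`: the source if it lies in `Ω_j^{(j)}`, else the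
target) of level exactly `j` — `lev_eq_of_base`; so besides the bonds based at their source there are ENTERING bonds, based at their target, whose source block lies in
layer `j − 1`); (2.20) p. 226 and [3] (1.18) p. 20 (the straight-tube average, r03's `qwt`; in block coordinates: `B6AvgWeightsKLevelV1`).

WHY THIS FILE (dag-n06-i gen 13, N06 bundle F4, row 26).  `B9Eq3132CoerciveVariational.hcoA_of_testFamily` reduces row 26's coercivity binder to ROW 17's `hΔA` plus a
test family with (P′2) `(1−θ)‖Ψ‖² ≤ Re tr⟨Q(U)(TΨ), Λ⁻¹Ψ⟩` and (P′1).  The written repair's Lemma P′ places one tent per index bond on an ε-layer of its base block;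
(P′2) then needs: (a) the tent's own weight there is `≥ (1−ε)L^{−jD}`; (b) ALL OTHER index bonds of the same level together give that layer weight `≤ εL^{−jD}`; (c) the
bonds of level `j+1` together give `≤ L^{−(j+1)D}`; (d) no other level sees it.  (b)–(c) follow from ONE fact proved here without any case analysis of neighbours:
the bonds of a fixed level and direction have pairwise disjoint «start sets» along a fine bond's contour, so their weights at a fine bond add up to at most the plateau.

WHAT IS PROVED (sorry-free).
* §1 `eq_of_lvl_dir_src` (two index bonds with the same level, direction and source block coincide), `iterBlockOf_backSite_pow` (`Bʲ(x − Lʲe_μ) = Bʲ(x) − e_μ`),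
  `iterBlockOf_backSite_pow_eq_src`, `eq_of_lvl_dir_tgt`.
* §2 ★★ `sum_qwt_lvl_le` — `Σ_{y : j(y) = J} q_y(f) ≤ L^{−JD}` for every fine bond `f` and level `J` (per contour parameter `t` at most one index bond starts the contour).
* §3 `lvl_observer` — if `f₋ ∈ Bʲ(base y)` and `q_{y₂}(f) ≠ 0` then `j(y₂) = j(y)` or `j(y₂) = j(y) + 1` (`lev_eq_of_base` + `lev_ends_bounds`).
* §4 the layer: `InLayer ε y f` (direction `dir y`, `f₋ ∈ Bʲ(base y)`, and `(1−ε)Lʲ ≤ u+1` if `base y = y₋`, `u + 1 ≤ εLʲ` otherwise), ★ `qwt_ge_of_inLayer`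
  (`(1−ε)L^{−jD} ≤ q_y(f)`), ★ `sum_qwt_lvl_other_le` (`Σ_{y₂ ≠ y, j(y₂) = j} q_{y₂}(f) ≤ εL^{−jD}` on the layer), `sum_qwt_succ_lvl_le` (`Σ_{j(y₂) = j+1} q_{y₂}(f) ≤ L^{−(j+1)D}`),
  `qwt_eq_zero_of_lvl_ne` (other levels give `0`).
* §5 profile families: `ProfileOK ε θ` (non-negative, supported in the layers, normalised `Σ_f q_y(f)θ_y(f) = 1`) and `sum_profile_le` (`Σ_f θ_y(f) ≤ L^{jD}∕(1−ε)`),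
  `profile_unique` (a fine bond lies in the support of at most one tent: the base block has level `lev(f₋)`, and far∕near layers of one block are disjoint for `ε < 1∕2`).

HONEST SCOPE.  Elementary combinatorics of [4] (2.3)∕(2.20) on r03's carriers; nothing of [B9]'s estimates; count-neutral; NOT a node discharge.  Cell `pub-ymgap` (HUMAN RULING
D-0062), Track A node N06 [B9], seat `pub-ymgap-dag-n06-i` (gen 13), 2026-08-27; a NEW file.
-/

noncomputable section

namespace Literature.MathematicalPhysics.QuantumFieldTheory.Balaban1983to89.B6IndexBondLayersKLevelV1

open Finset LatticeFieldCalculus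
open B5Eq118OneStroke (iterBlockOf iterBlock mem_iterBlock iterBlockOf_succ)
open Node00 (IBondY FBondY)
open B6KLevelCensusIndexV1 (KIdx)
open B6Ineq2142KLevelV1 (qwt qwt_nonneg cQ cQ_pos lvl lvl_le lvl_le_mK base base_mem not_deep_base lev_eq_of_base lev_ends_bounds)
open B6GlobalChartV1 (PV toBox)
open B6AvgWeightsKLevelV1 (muOff muOff_lt backSite qwt_eq_card qwt_eq_zero_of_dir_ne qwt_eq_of_src_block qwt_eq_of_tgt_block qwt_eq_zero_of_block_ne cQ_mul_pow
  qwt_ge_of_far PV_L lvl_le_mK' one_ne_zero_sites iterBlockOf_backSite_apply_self)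
open B9Eq3132Ineq2142Covariant (two_le_RMh ends_of_qwt_ne_zero)
open B9GeoLemma21KLevelV1 (one_le_k)

variable {d ℓ : ℕ} {hd : 1 ≤ d + 1} {hL : Odd (ℓ + 1) ∧ 1 < ℓ + 1} {b₀ b₁ : ℝ} (i : KIdx d ℓ hd hL b₀ b₁)

/-! ## §1 Index bonds are determined by level, direction and one block -/

/-- **TWO INDEX BONDS WITH THE SAME LEVEL, DIRECTION AND SOURCE BLOCK COINCIDE** (read off a common fine site of the source block).
[cite: Balaban1984PropagatorsII, (2.3) p.224, bookkeeping] -/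
theorem eq_of_lvl_dir_src {y y₂ : IBondY i} (hl : lvl i.hN i.D i.hk y₂ = lvl i.hN i.D i.hk y) (hdir : y₂.1.2.dir = y.1.2.dir)
    {x : Site (PV d ℓ i.m i.K hd hL) 0} (hx : iterBlockOf (lvl i.hN i.D i.hk y) x = y.1.2.src) (hx₂ : iterBlockOf (lvl i.hN i.D i.hk y₂) x = y₂.1.2.src) :
    y₂ = y := by
  rcases y with ⟨⟨j, ⟨s, μ⟩⟩, hb⟩
  rcases y₂ with ⟨⟨j₂, ⟨s₂, μ₂⟩⟩, hb₂⟩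
  have hj : j₂ = j := Fin.ext hl
  subst hj
  have hμ : μ₂ = μ := hdir
  subst hμ
  have hs : s = s₂ := hx.symm.trans hx₂
  subst hs
  rfl

/-- the block of `x − Lʲe_μ` is the `μ`-predecessor of the block of `x`. [cite: Balaban1984PropagatorsI, (1.18) p.20, bookkeeping] -/
theorem iterBlockOf_backSite_pow {P : Params} {j : ℕ} (hj : j ≤ P.m + P.K) (x : Site P 0) (μ : Fin P.d) :
    iterBlockOf j (backSite x μ (P.L ^ j)) = (iterBlockOf j x).unshift μ := by
  funext ν
  by_cases hν : ν = μ
  · subst hν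
    rw [iterBlockOf_backSite_apply_self hj x ν le_rfl, if_pos (muOff_lt j x ν)]
    simp [Site.unshift]
  · rw [B6AvgWeightsKLevelV1.iterBlockOf_backSite_apply_ne hj x hν]
    simp [Site.unshift, Function.update_of_ne hν]

/-- a fine site of the TARGET block, moved back by `Lʲ`, lies in the SOURCE block. [cite: Balaban1984PropagatorsI, (1.18) p.20 («x(b) is a point in Bᵏ(b₊)»), bookkeeping] -/
theorem iterBlockOf_backSite_pow_eq_src (y : IBondY i) {x : Site (PV d ℓ i.m i.K hd hL) 0} (hx : iterBlockOf (lvl i.hN i.D i.hk y) x = y.1.2.tgt) :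
    iterBlockOf (lvl i.hN i.D i.hk y) (backSite x y.1.2.dir ((ℓ + 1) ^ (lvl i.hN i.D i.hk y))) = y.1.2.src := by
  have h := iterBlockOf_backSite_pow (P := PV d ℓ i.m i.K hd hL) (lvl_le_mK' i y) x y.1.2.dir
  rw [PV_L] at h
  rw [h, hx]
  exact (shiftEquiv (P := PV d ℓ i.m i.K hd hL) y.1.2.dir).symm_apply_apply y.1.2.src

/-- two index bonds with the same level, direction and TARGET block coincide. [cite: Balaban1984PropagatorsII, (2.3) p.224, bookkeeping] -/
theorem eq_of_lvl_dir_tgt {y y₂ : IBondY i} (hl : lvl i.hN i.D i.hk y₂ = lvl i.hN i.D i.hk y) (hdir : y₂.1.2.dir = y.1.2.dir)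
    {x : Site (PV d ℓ i.m i.K hd hL) 0} (hx : iterBlockOf (lvl i.hN i.D i.hk y) x = y.1.2.tgt) (hx₂ : iterBlockOf (lvl i.hN i.D i.hk y₂) x = y₂.1.2.tgt) :
    y₂ = y := by
  have h1 := iterBlockOf_backSite_pow_eq_src i y hx
  have h2 := iterBlockOf_backSite_pow_eq_src i y₂ hx₂
  have e : backSite x y₂.1.2.dir ((ℓ + 1) ^ (lvl i.hN i.D i.hk y₂)) = backSite x y.1.2.dir ((ℓ + 1) ^ (lvl i.hN i.D i.hk y)) := by
    rw [hl, hdir]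
  rw [e] at h2
  exact eq_of_lvl_dir_src i hl hdir h1 h2

/-! ## §2 ★★ The total weight a fine bond receives from one level is at most the plateau -/

open Classical in
/-- ★★ **`Σ_{y : j(y) = J} q_y(f) ≤ L^{−JD}`**: along the contour of `f` each start `f₋ − te_μ` (`t < L^J`) lies in the source block of AT MOST ONE index bond of level `J` and
direction `dir f` (§1), and bonds of another direction give `0`; so the counts of `B6AvgWeightsKLevelV1.qwt_eq_card` add up to at most `L^J`, i.e. the weights to at most
`cQ_J·L^J = L^{−JD}` — the straight-tube averages of one level form a sub-partition of unity. [cite: Balaban1984PropagatorsI, (1.18) p.20, (1.15) p.19; Balaban1984PropagatorsII, (2.20) p.226] -/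
theorem sum_qwt_lvl_le (J : ℕ) (f : FBondY i) :
    ∑ y ∈ Finset.univ.filter (fun y : IBondY i => lvl i.hN i.D i.hk y = J), qwt i.hN i.D i.hk y f ≤ ((((ℓ + 1 : ℕ) : ℝ) ^ (d + 1)) ^ J)⁻¹ := by
  -- restrict to the bonds of the direction of `f` (the others have weight 0)
  have hsub : Finset.univ.filter (fun y : IBondY i => lvl i.hN i.D i.hk y = J ∧ f.dir = y.1.2.dir) ⊆
      Finset.univ.filter (fun y : IBondY i => lvl i.hN i.D i.hk y = J) := by
    intro y hy
    rw [Finset.mem_filter] at hy ⊢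
    exact ⟨hy.1, hy.2.1⟩
  have hzero : ∀ y ∈ Finset.univ.filter (fun y : IBondY i => lvl i.hN i.D i.hk y = J),
      y ∉ Finset.univ.filter (fun y : IBondY i => lvl i.hN i.D i.hk y = J ∧ f.dir = y.1.2.dir) → qwt i.hN i.D i.hk y f = 0 := by
    intro y hy hy'
    rw [Finset.mem_filter] at hy hy'
    exact qwt_eq_zero_of_dir_ne i y f fun h => hy' ⟨hy.1, hy.2, h⟩
  rw [← Finset.sum_subset hsub hzero]
  -- each weight is `cQ_J` times a count over `t < L^J`
  have hterm : ∀ y ∈ Finset.univ.filter (fun y : IBondY i => lvl i.hN i.D i.hk y = J ∧ f.dir = y.1.2.dir), qwt i.hN i.D i.hk y f =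
      cQ (d := d) (ℓ := ℓ) J * ∑ t ∈ Finset.range ((ℓ + 1) ^ J),
        (if iterBlockOf (lvl i.hN i.D i.hk y) (backSite f.src f.dir t) = y.1.2.src then (1 : ℝ) else 0) := by
    intro y hy
    rw [Finset.mem_filter] at hy
    obtain ⟨-, hl, hdir⟩ := hy
    have e1 : cQ (d := d) (ℓ := ℓ) (lvl i.hN i.D i.hk y) = cQ (d := d) (ℓ := ℓ) J := by rw [hl]
    have e2 : Finset.range ((ℓ + 1) ^ (lvl i.hN i.D i.hk y)) = Finset.range ((ℓ + 1) ^ J) := by rw [hl]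
    rw [qwt_eq_card i y f hdir, e1, Finset.card_filter, e2, hdir]
    push_cast
    rfl
  -- for each `t`, at most one such bond has source block `Bᴶ(f₋ − te_μ)`
  have hone : ∀ t ∈ Finset.range ((ℓ + 1) ^ J),
      ∑ y ∈ Finset.univ.filter (fun y : IBondY i => lvl i.hN i.D i.hk y = J ∧ f.dir = y.1.2.dir),
        (if iterBlockOf (lvl i.hN i.D i.hk y) (backSite f.src f.dir t) = y.1.2.src then (1 : ℝ) else 0) ≤ 1 := by
    intro t _
    rw [← Finset.sum_filter]
    have hcard : ((Finset.univ.filter (fun y : IBondY i => lvl i.hN i.D i.hk y = J ∧ f.dir = y.1.2.dir)).filter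
        fun y : IBondY i => iterBlockOf (lvl i.hN i.D i.hk y) (backSite f.src f.dir t) = y.1.2.src).card ≤ 1 := by
      refine Finset.card_le_one.2 fun y hy y₂ hy₂ => ?_
      rw [Finset.mem_filter, Finset.mem_filter] at hy hy₂
      obtain ⟨⟨-, hl, hdir⟩, hb⟩ := hy
      obtain ⟨⟨-, hl₂, hdir₂⟩, hb₂⟩ := hy₂
      exact eq_of_lvl_dir_src i (hl.trans hl₂.symm) (hdir.symm.trans hdir₂) hb₂ hb
    have h := Finset.sum_le_sum (fun y (_ : y ∈ (Finset.univ.filter (fun y : IBondY i => lvl i.hN i.D i.hk y = J ∧ f.dir = y.1.2.dir)).filter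
        fun y : IBondY i => iterBlockOf (lvl i.hN i.D i.hk y) (backSite f.src f.dir t) = y.1.2.src) => le_refl (1 : ℝ))
    rw [Finset.sum_const, nsmul_eq_mul, mul_one] at h
    exact le_trans (by simp) (by exact_mod_cast hcard : (((Finset.univ.filter (fun y : IBondY i => lvl i.hN i.D i.hk y = J ∧ f.dir = y.1.2.dir)).filter
        fun y : IBondY i => iterBlockOf (lvl i.hN i.D i.hk y) (backSite f.src f.dir t) = y.1.2.src).card : ℝ) ≤ 1)
  calc ∑ y ∈ Finset.univ.filter (fun y : IBondY i => lvl i.hN i.D i.hk y = J ∧ f.dir = y.1.2.dir), qwt i.hN i.D i.hk y f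
      = ∑ y ∈ Finset.univ.filter (fun y : IBondY i => lvl i.hN i.D i.hk y = J ∧ f.dir = y.1.2.dir),
          cQ (d := d) (ℓ := ℓ) J * ∑ t ∈ Finset.range ((ℓ + 1) ^ J),
            (if iterBlockOf (lvl i.hN i.D i.hk y) (backSite f.src f.dir t) = y.1.2.src then (1 : ℝ) else 0) := Finset.sum_congr rfl hterm
    _ = cQ (d := d) (ℓ := ℓ) J * ∑ t ∈ Finset.range ((ℓ + 1) ^ J),
          ∑ y ∈ Finset.univ.filter (fun y : IBondY i => lvl i.hN i.D i.hk y = J ∧ f.dir = y.1.2.dir),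
            (if iterBlockOf (lvl i.hN i.D i.hk y) (backSite f.src f.dir t) = y.1.2.src then (1 : ℝ) else 0) := by
        rw [← Finset.mul_sum, Finset.sum_comm]
    _ ≤ cQ (d := d) (ℓ := ℓ) J * ∑ t ∈ Finset.range ((ℓ + 1) ^ J), (1 : ℝ) :=
        mul_le_mul_of_nonneg_left (Finset.sum_le_sum hone) (cQ_pos _).le
    _ = ((((ℓ + 1 : ℕ) : ℝ) ^ (d + 1)) ^ J)⁻¹ := by
        rw [Finset.sum_const, Finset.card_range, nsmul_eq_mul, mul_one, ← cQ_mul_pow]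
        push_cast
        ring

/-! ## §3 The level of an observer of the base block -/

/-- **AN INDEX BOND THAT SEES A FINE BOND OF THE BASE BLOCK OF `y` HAS LEVEL `j(y)` OR `j(y)+1`**: the fine sites of `Bʲ(base y)` have level exactly `j(y)`
(`lev_eq_of_base`), and both end blocks of an index bond of level `J` have level `J − 1` or `J` (`lev_ends_bounds`). [cite: Balaban1984PropagatorsII, (2.2)–(2.4) p.224] -/
theorem lvl_observer {y y₂ : IBondY i} {f : FBondY i} (hf : iterBlockOf (lvl i.hN i.D i.hk y) f.src = base i.hN i.D i.hk y)
    (hq : qwt i.hN i.D i.hk y₂ f ≠ 0) : lvl i.hN i.D i.hk y₂ = lvl i.hN i.D i.hk y ∨ lvl i.hN i.D i.hk y₂ = lvl i.hN i.D i.hk y + 1 := by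
  have h1 := lev_eq_of_base i.hN i.D i.hk (one_le_k i) y hf
  have h2 := lev_ends_bounds i.hN i.D i.hk (one_le_k i) (two_le_RMh i) y₂ (ends_of_qwt_ne_zero i hq)
  omega

/-- hence an index bond of any other level gives the base block weight `0`. [cite: Balaban1984PropagatorsII, (2.2)–(2.4) p.224] -/
theorem qwt_eq_zero_of_lvl_ne {y y₂ : IBondY i} {f : FBondY i} (hf : iterBlockOf (lvl i.hN i.D i.hk y) f.src = base i.hN i.D i.hk y)
    (h₁ : lvl i.hN i.D i.hk y₂ ≠ lvl i.hN i.D i.hk y) (h₂ : lvl i.hN i.D i.hk y₂ ≠ lvl i.hN i.D i.hk y + 1) : qwt i.hN i.D i.hk y₂ f = 0 := by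
  by_contra hq
  rcases lvl_observer i hf hq with h | h
  · exact h₁ h
  · exact h₂ h

/-! ## §4 The ε-layer of the base block and the weights there -/

/-- **THE ε-LAYER OF THE BASE BLOCK OF `y`** — the support of the tent of `y`: fine bonds of direction `dir y` with source in `Bʲ(base y)`, on the FAR side
(`(1−ε)Lʲ ≤ u + 1`, adjacent to `y₊`) when the base is the source, on the NEAR side (`u + 1 ≤ εLʲ`, adjacent to `y₋`) when the base is the target (entering bonds).
[cite: Balaban1984PropagatorsII, (2.3) p.224, (2.147) p.249 (the test functions behind the lower bound)] -/
def InLayer (ε : ℝ) (y : IBondY i) (f : FBondY i) : Prop :=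
  f.dir = y.1.2.dir ∧ iterBlockOf (lvl i.hN i.D i.hk y) f.src = base i.hN i.D i.hk y ∧
    (base i.hN i.D i.hk y = y.1.2.src →
      (1 - ε) * (((ℓ + 1 : ℕ) : ℝ) ^ (lvl i.hN i.D i.hk y)) ≤ (muOff (lvl i.hN i.D i.hk y) f.src y.1.2.dir : ℝ) + 1) ∧
    (base i.hN i.D i.hk y ≠ y.1.2.src →
      (muOff (lvl i.hN i.D i.hk y) f.src y.1.2.dir : ℝ) + 1 ≤ ε * (((ℓ + 1 : ℕ) : ℝ) ^ (lvl i.hN i.D i.hk y)))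

/-- if the base is not the source it is the target. [cite: Balaban1984PropagatorsII, (2.3) p.224, bookkeeping] -/
theorem base_eq_tgt_of_ne {y : IBondY i} (h : base i.hN i.D i.hk y ≠ y.1.2.src) : base i.hN i.D i.hk y = y.1.2.tgt := by
  rcases B6Ineq2142KLevelV1.ends_eq i.hN i.D i.hk y with ⟨hb, -⟩ | ⟨hb, -⟩
  · exact absurd hb h
  · exact hb

/-- ★ **THE OWN WEIGHT ON THE LAYER IS AT LEAST `(1−ε)L^{−jD}`** (rising tent on the far layer of the source, falling tent on the near layer of the target).
[cite: Balaban1984PropagatorsI, (1.18) p.20; Balaban1984PropagatorsII, (2.147) p.249] -/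
theorem qwt_ge_of_inLayer {ε : ℝ} {y : IBondY i} {f : FBondY i} (h : InLayer i ε y f) :
    (1 - ε) * ((((ℓ + 1 : ℕ) : ℝ) ^ (d + 1)) ^ (lvl i.hN i.D i.hk y))⁻¹ ≤ qwt i.hN i.D i.hk y f := by
  obtain ⟨hdir, hblk, hfar, hnear⟩ := h
  by_cases hb : base i.hN i.D i.hk y = y.1.2.src
  · exact qwt_ge_of_far i y f hdir (hblk.trans hb) (hfar hb)
  · have hblk' : iterBlockOf (lvl i.hN i.D i.hk y) f.src = y.1.2.tgt := hblk.trans (base_eq_tgt_of_ne i hb)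
    rw [qwt_eq_of_tgt_block i y f hdir hblk', ← cQ_mul_pow, mul_comm (1 - ε), mul_assoc]
    refine mul_le_mul_of_nonneg_left ?_ (cQ_pos _).le
    have h2 := hnear hb
    push_cast at h2 ⊢
    nlinarith [h2]

open Classical in
/-- ★ **THE OTHER BONDS OF THE SAME LEVEL GIVE THE LAYER WEIGHT AT MOST `εL^{−jD}`** (§2's plateau bound minus the own weight).
[cite: Balaban1984PropagatorsI, (1.18) p.20; Balaban1984PropagatorsII, (2.3) p.224] -/
theorem sum_qwt_lvl_other_le {ε : ℝ} {y : IBondY i} {f : FBondY i} (h : InLayer i ε y f) :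
    ∑ y₂ ∈ Finset.univ.filter (fun y₂ : IBondY i => lvl i.hN i.D i.hk y₂ = lvl i.hN i.D i.hk y ∧ y₂ ≠ y), qwt i.hN i.D i.hk y₂ f ≤
      ε * ((((ℓ + 1 : ℕ) : ℝ) ^ (d + 1)) ^ (lvl i.hN i.D i.hk y))⁻¹ := by
  have htot := sum_qwt_lvl_le i (lvl i.hN i.D i.hk y) f
  have hown := qwt_ge_of_inLayer i h
  have hsplit : ∑ y₂ ∈ Finset.univ.filter (fun y₂ : IBondY i => lvl i.hN i.D i.hk y₂ = lvl i.hN i.D i.hk y), qwt i.hN i.D i.hk y₂ f =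
      qwt i.hN i.D i.hk y f +
        ∑ y₂ ∈ Finset.univ.filter (fun y₂ : IBondY i => lvl i.hN i.D i.hk y₂ = lvl i.hN i.D i.hk y ∧ y₂ ≠ y), qwt i.hN i.D i.hk y₂ f := by
    have hmem : y ∈ Finset.univ.filter (fun y₂ : IBondY i => lvl i.hN i.D i.hk y₂ = lvl i.hN i.D i.hk y) := by simp
    rw [← Finset.add_sum_erase _ _ hmem]
    congr 1
    refine Finset.sum_congr ?_ fun _ _ => rfl
    ext y₂
    simp [Finset.mem_erase, and_comm]
  rw [hsplit] at htot
  linarith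

open Classical in
/-- **THE BONDS OF THE NEXT LEVEL GIVE THE LAYER WEIGHT AT MOST `L^{−(j+1)D}`** (§2 at level `j + 1`). [cite: Balaban1984PropagatorsI, (1.18) p.20; Balaban1984PropagatorsII, (2.3) p.224] -/
theorem sum_qwt_succ_lvl_le (y : IBondY i) (f : FBondY i) :
    ∑ y₂ ∈ Finset.univ.filter (fun y₂ : IBondY i => lvl i.hN i.D i.hk y₂ = lvl i.hN i.D i.hk y + 1), qwt i.hN i.D i.hk y₂ f ≤
      ((((ℓ + 1 : ℕ) : ℝ) ^ (d + 1)) ^ (lvl i.hN i.D i.hk y + 1))⁻¹ :=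
  sum_qwt_lvl_le i _ f

/-! ## §5 Profile families on the layers -/

/-- **AN ADMISSIBLE PROFILE FAMILY** `θ : 𝔅 → (fine bonds) → ℝ` for the tents: non-negative, the tent of `y` supported in the ε-layer of the base block of `y`, and
NORMALISED against the own weights, `Σ_f q_y(f)·θ_y(f) = 1` (so that `Q(U)` applied to the tent returns exactly the amplitude at `y`).
[cite: Balaban1984PropagatorsII, (2.147) p.249 (the test functions behind the lower bound); Balaban1984PropagatorsI, (1.18) p.20] -/
structure ProfileOK (ε : ℝ) (θ : IBondY i → FBondY i → ℝ) : Prop where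
  nonneg : ∀ y f, 0 ≤ θ y f
  supp : ∀ y f, θ y f ≠ 0 → InLayer i ε y f
  norm : ∀ y, ∑ f, qwt i.hN i.D i.hk y f * θ y f = 1

/-- **THE TOTAL MASS OF A TENT IS AT MOST `L^{jD}∕(1−ε)`** (normalisation against own weights `≥ (1−ε)L^{−jD}` on the support).
[cite: Balaban1984PropagatorsI, (1.18) p.20; Balaban1984PropagatorsII, (2.147) p.249] -/
theorem sum_profile_le {ε : ℝ} (hε : ε < 1) {θ : IBondY i → FBondY i → ℝ} (hθ : ProfileOK i ε θ) (y : IBondY i) :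
    ∑ f, θ y f ≤ (((ℓ + 1 : ℕ) : ℝ) ^ (d + 1)) ^ (lvl i.hN i.D i.hk y) / (1 - ε) := by
  set P : ℝ := (((ℓ + 1 : ℕ) : ℝ) ^ (d + 1)) ^ (lvl i.hN i.D i.hk y) with hP
  have hP0 : 0 < P := by positivity
  have hε' : 0 < 1 - ε := by linarith
  have hkey : (1 - ε) * P⁻¹ * ∑ f, θ y f ≤ 1 := by
    have h1 : (1 - ε) * P⁻¹ * ∑ f, θ y f ≤ ∑ f, qwt i.hN i.D i.hk y f * θ y f := by
      rw [Finset.mul_sum]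
      refine Finset.sum_le_sum fun f _ => ?_
      by_cases hz : θ y f = 0
      · rw [hz, mul_zero, mul_zero]
      · exact mul_le_mul_of_nonneg_right (qwt_ge_of_inLayer i (hθ.supp y f hz)) (hθ.nonneg y f)
    rwa [hθ.norm y] at h1
  rw [le_div_iff₀ hε', mul_comm]
  have := mul_le_mul_of_nonneg_left hkey hP0.le
  calc (1 - ε) * ∑ f, θ y f = P * ((1 - ε) * P⁻¹ * ∑ f, θ y f) := by field_simp
    _ ≤ P * 1 := this
    _ = P := mul_one _

/-- **A FINE BOND LIES IN THE SUPPORT OF AT MOST ONE TENT** (for `ε ≤ 1∕2`): the base block's fine sites have level `j(y)`, so the level of a tent containing `f` is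
`lev(f₋)`; at that level the base block is the `j`-block of `f₋` and the two candidate bonds (based at their source ∕ at their target) put their tents on DISJOINT layers.
[cite: Balaban1984PropagatorsII, (2.3)–(2.4) p.224, (2.147) p.249] -/
theorem profile_unique {ε : ℝ} (hε : ε < 1 / 2) {θ : IBondY i → FBondY i → ℝ} (hθ : ProfileOK i ε θ) {y y' : IBondY i} {f : FBondY i}
    (hy : θ y f ≠ 0) (hy' : θ y' f ≠ 0) : y' = y := by
  obtain ⟨hdir, hblk, hfar, hnear⟩ := hθ.supp y f hy
  obtain ⟨hdir', hblk', hfar', hnear'⟩ := hθ.supp y' f hy'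
  -- same level: both base blocks contain `f₋`, whose level is the level of either bond
  have hl : lvl i.hN i.D i.hk y' = lvl i.hN i.D i.hk y := by
    have h1 := lev_eq_of_base i.hN i.D i.hk (one_le_k i) y hblk
    have h2 := lev_eq_of_base i.hN i.D i.hk (one_le_k i) y' hblk'
    omega
  have hdd : y'.1.2.dir = y.1.2.dir := hdir'.symm.trans hdir
  have hL1 : (1 : ℝ) ≤ ((ℓ + 1 : ℕ) : ℝ) ^ (lvl i.hN i.D i.hk y) := one_le_pow₀ (by exact_mod_cast Nat.succ_le_succ (Nat.zero_le ℓ))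
  by_cases hb : base i.hN i.D i.hk y = y.1.2.src
  · by_cases hb' : base i.hN i.D i.hk y' = y'.1.2.src
    · exact eq_of_lvl_dir_src i hl hdd (hblk.trans hb) (hblk'.trans hb')
    · -- `y` far, `y′` near on the same block and offset: impossible for ε < 1/2
      exfalso
      have h1 := hfar hb
      have h2 := hnear' hb'
      rw [hl, hdd] at h2
      nlinarith
  · by_cases hb' : base i.hN i.D i.hk y' = y'.1.2.src
    · exfalso
      have h1 := hnear hb
      have h2 := hfar' hb'
      rw [hl, hdd] at h2
      nlinarith
    · exact eq_of_lvl_dir_tgt i hl hdd (hblk.trans (base_eq_tgt_of_ne i hb)) (hblk'.trans (base_eq_tgt_of_ne i hb'))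

end Literature.MathematicalPhysics.QuantumFieldTheory.Balaban1983to89.B6IndexBondLayersKLevelV1

end
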